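import Summits.KontsevichZagierPeriods.KontsevichZagierPeriods.Theorems.LinRedNormalFormArrangementNormalFormStubRebaseSimplePosOnePosHUFrame
import Summits.KontsevichZagierPeriods.KontsevichZagierPeriods.Theorems.LinRedNormalFormArrangementNormalFormStubRebaseSimplePosOnePosParTripleTools

/-!
# Stub `stub_rebaseSimplePosOnePos` (crux `ArrangementNormalForm`, line `janus-bands`) —
part `HUSplit`: re-selection of the distinguished coordinate for a one-fibre band (`B = 2`)

Towards the residue `HU` of the one-fibre rebase over the base `(x₁, x₂, y)`. A literal one-fibre
datum `[{rows, u < t < v}, R(x')/(y − ℓ₂(x')) · 1/t]` (`glit 2 1 p L e ℓ₁ ℓ₂ 0 1 (some 0)`) and a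
rational base direction `d` (`d_y ≠ 0`) which moves the lower bound (`∂_d u ≠ 0`) and leaves a
level `κ = u + θ (v − u)`, `0 < θ < 1`, invariant (`∂_d κ = 0`; for a parallel band this is
achieved by the `y`-component of `d` once `∂_d (v − u) ≠ 0`). IF the letters of the datum read as
an arrangement over the full base — the lifted silent factors `Lⱼ(x')` and the pole form
`y − ℓ₂(x')` (`RebasePos.jjL`, exponents `RebasePos.jjE`) — satisfy in the direction `d` the
hypotheses of the separation engine on the base cell (`hact`, `hpole`, `hrat` of part `HUFrame`),
THEN `[s]` lies in the subgroup generated by `GG 2 2 1` modulo `KZ.relations`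
(`RebasePos.good_reselect`):
* cut the fibre at `κ` (rule 1a, `RebasePos.cutFibre`);
* on the half `(u, κ)` pull back `t = αt* + g(x', y)` with `α = ∂_d u`, `g = u − α Z`, `Z = y/d_y`
  (rule 2, `RebasePos.pull`): the bounds become `Z` and `(κ − g)/α`, the letter `−g/α`, and
  `∂_d g = ∂_d (κ − g) = 0` — the fibre structure of part `HUFrame` (`RebasePos.good_half`);
  the half `(κ, v)` likewise with `α = ∂_d v = (1 − θ) ∂_d (v − u) ≠ 0`;
* read the pulled datum as an arrangement over the full base (`RebasePos.glit_jj`) and conclude by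
  `RebasePos.good_frame`.
Registered as `rebaseSimplePos_reselect`.

References: M. Kontsevich, D. Zagier, *Periods* (2001), §1.2, rules (1a), (1b), (2).
-/

noncomputable section

open Set MeasureTheory MvPolynomial
open Literature.NumberTheory.Transcendental Literature.ModelTheory.ExponentialFields

namespace Summit.KontsevichZagierPeriods.ArrangementNormalForm.JanusBands

namespace RebasePos

open SeparatePos

section JJRead

variable {B m : ℕ}

/-- The pole form `y − ℓ(x')` as a full-base affine form. -/
def poleX (ℓ : (Fin B → ℚ) × ℚ) : (Fin (B + 1) → ℚ) × ℚ :=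
  ((Fin.snoc (-ℓ.1) 1 : Fin (B + 1) → ℚ), -ℓ.2)

/-- `poleX ℓ` evaluates to `y − ℓ(x')`. -/
theorem affF_poleX (ℓ : (Fin B → ℚ) × ℚ) (z : Fin (B + 1 + 1) → ℝ) :
    affF B 1 (poleX ℓ) z = z (Fin.castAdd 1 (Fin.last B)) - affB B 1 ℓ z := by
  simp only [affF, affB, poleX, Fin.sum_univ_castSucc, Fin.snoc_castSucc, Fin.snoc_last,
    Pi.neg_apply, Rat.cast_neg, Rat.cast_one, one_mul, neg_mul, Finset.sum_neg_distrib]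
  ring

/-- The letters of a one-fibre datum read as an arrangement over the FULL base: the lifted
silent factors and, last, the pole form. -/
def jjL (L : Fin m → (Fin B → ℚ) × ℚ) (ℓ₂ : (Fin B → ℚ) × ℚ) : Fin (m + 1) → (Fin (B + 1) → ℚ) × ℚ :=
  Fin.snoc (fun j => liftX (L j)) (poleX ℓ₂)

/-- The exponents of `jjL`: the given ones and `1` for the pole. -/
def jjE (e : Fin m → ℕ) : Fin (m + 1) → ℕ := Fin.snoc e 1

/-- The silent letters of `jjL`. -/
@[simp] theorem jjL_castSucc (L : Fin m → (Fin B → ℚ) × ℚ) (ℓ₂ : (Fin B → ℚ) × ℚ) (j : Fin m) :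
    jjL L ℓ₂ (Fin.castSucc j) = liftX (L j) := by
  simp [jjL]

/-- The last letter of `jjL` is the pole form. -/
@[simp] theorem jjL_last (L : Fin m → (Fin B → ℚ) × ℚ) (ℓ₂ : (Fin B → ℚ) × ℚ) :
    jjL L ℓ₂ (Fin.last m) = poleX ℓ₂ := by
  simp [jjL]

/-- The exponents of the silent letters. -/
@[simp] theorem jjE_castSucc (e : Fin m → ℕ) (j : Fin m) : jjE e (Fin.castSucc j) = e j := by
  simp [jjE]

/-- The exponent of the pole form is `1`. -/
@[simp] theorem jjE_last (e : Fin m → ℕ) : jjE e (Fin.last m) = 1 := by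
  simp [jjE]

/-- The pole letter is always active. -/
theorem jjE_last_ne_zero (e : Fin m → ℕ) : jjE e (Fin.last m) ≠ 0 := by
  simp [jjE]

/-- The `y`-coefficient of the pole form is `1`. -/
@[simp] theorem poleX_fst_last (ℓ : (Fin B → ℚ) × ℚ) : (poleX ℓ).1 (Fin.last B) = 1 := by
  simp [poleX]

/-- The `x'`-coefficients of the pole form. -/
@[simp] theorem poleX_fst_castSucc (ℓ : (Fin B → ℚ) × ℚ) (i : Fin B) :
    (poleX ℓ).1 (Fin.castSucc i) = -ℓ.1 i := by
  simp [poleX]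

/-- **Re-reading a literal one-fibre datum with a simple pole as an arrangement over the full
base** (exponents `n₁ = 0`, `n₂ = 1`, any letter family). -/
theorem glit_jj (p : MvPolynomial (Fin B) ℚ) (L : Fin m → (Fin B → ℚ) × ℚ) (e : Fin m → ℕ)
    (ℓ₁ ℓ₂ : (Fin B → ℚ) × ℚ) (a : Fin 1 → Option ((Fin (B + 1) → ℚ) × ℚ)) (z : Fin (B + 1 + 1) → ℝ) :
    glit B 1 p L e ℓ₁ ℓ₂ 0 1 a z =
      MvPolynomial.aeval (fun i => z (Fin.castAdd 1 i)) (rename Fin.castSucc p) /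
        (∏ j, affF B 1 (jjL L ℓ₂ j) z ^ jjE e j) * fib B 1 a z := by
  have h1 : (∏ j, affF B 1 (jjL L ℓ₂ j) z ^ jjE e j) =
      (∏ j, affB B 1 (L j) z ^ e j) * (z (Fin.castAdd 1 (Fin.last B)) - affB B 1 ℓ₂ z) := by
    rw [Fin.prod_univ_castSucc]
    simp only [jjL, jjE, Fin.snoc_castSucc, Fin.snoc_last, affF_liftX, affF_poleX, pow_one]
  have h2 : MvPolynomial.aeval (fun i => z (Fin.castAdd 1 i)) (rename Fin.castSucc p) =
      MvPolynomial.aeval (fun i => z (Fin.castAdd 1 (Fin.castSucc i))) p := by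
    rw [aeval_rename]
    rfl
  rw [glit_eq, h1, h2, pow_zero, pow_one, mul_one_div, div_mul_eq_div_div]

end JJRead

section Reselect

variable {m m' : ℕ} (L : Fin m → (Fin 2 → ℚ) × ℚ) (e : Fin m → ℕ) (ℓ₁ ℓ₂ : (Fin 2 → ℚ) × ℚ)

/-- The pulled-back form along `t = μ t* + g(x', y)`: `c ↦ μ⁻¹ (c − g)`. -/
theorem pullC_eq (μ : ℚ) (g c : (Fin (2 + 1) → ℚ) × ℚ) :
    pullC μ (g.1 (Fin.last 2)) (restr 2 g) c = μ⁻¹ • (c - g) := by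
  refine Prod.ext (funext fun j => ?_) ?_
  · simp only [pullC, restr, Prod.smul_fst, Pi.smul_apply, Prod.fst_sub, Pi.sub_apply, smul_eq_mul]
    have : (Fin.snoc (fun i : Fin 2 => g.1 (Fin.castSucc i)) (g.1 (Fin.last 2)) : Fin (2 + 1) → ℚ) j = g.1 j := by
      refine Fin.lastCases ?_ (fun i => ?_) j
      · rw [Fin.snoc_last]
      · rw [Fin.snoc_castSucc]
    rw [this, div_eq_inv_mul]
  · simp only [pullC, restr, Prod.smul_snd, Prod.snd_sub, smul_eq_mul]
    rw [div_eq_inv_mul]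

/-- **One half of the re-selection.** A literal one-fibre band `(b₁, b₂)` with letter `0` one of
whose bounds `G` is invariant along `d` (`∂_d G = 0`) and whose other bound `X` is moved
(`∂_d X ≠ 0`): pull back `t = α t* + g`, `α = ∂_d X`, `g = X − α Z`, read over the full base,
and apply `good_frame`. -/
theorem good_half (s : KZ.IntegralRep (2 + 1 + 1)) (M : Fin m' → (Fin (2 + 1) → ℚ) × ℚ)
    (p : MvPolynomial (Fin 2) ℚ) (b₁ b₂ X G : (Fin (2 + 1) → ℚ) × ℚ) (d : Fin (2 + 1) → ℚ)
    (hd : d (Fin.last 2) ≠ 0) (hbd : Bornology.IsBounded s.domain)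
    (hdom : s.domain = gDom 2 1 m' M (fun _ => Sum.inr b₁) (fun _ => Sum.inr b₂))
    (hint : EqOn s.integrand (glit 2 1 p L e ℓ₁ ℓ₂ 0 1 (fun _ => some 0)) s.domain)
    (hXG : (b₁ = X ∧ b₂ = G) ∨ (b₁ = G ∧ b₂ = X)) (hX : dd X d ≠ 0) (hG : dd G d = 0)
    (hact : ∀ j, jjE e j ≠ 0 → (jjL L ℓ₂ j).1 ≠ 0 → dd (jjL L ℓ₂ j) d ≠ 0)
    (hpole : ∀ j, dd (jjL L ℓ₂ j) d ≠ 0 → jjE e j ≠ 0 → ∀ z : Fin (2 + 1 + 1) → ℝ,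
      (∀ i, 0 < affF 2 1 (M i) z) → affF 2 1 (jjL L ℓ₂ j) z ≠ 0)
    (hrat : ∀ j j', dd (jjL L ℓ₂ j) d ≠ 0 → dd (jjL L ℓ₂ j') d ≠ 0 → jjE e j ≠ 0 → jjE e j' ≠ 0 →
      dd (jjL L ℓ₂ j') d • jjL L ℓ₂ j ≠ dd (jjL L ℓ₂ j) d • jjL L ℓ₂ j' →
      ∃ C : ℝ, ∀ z : Fin (2 + 1 + 1) → ℝ, (∀ i, 0 < affF 2 1 (M i) z) →
      |affF 2 1 (jjL L ℓ₂ j') z| ≤ C * |(dd (jjL L ℓ₂ j) d : ℝ) * affF 2 1 (jjL L ℓ₂ j') z -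
        (dd (jjL L ℓ₂ j') d : ℝ) * affF 2 1 (jjL L ℓ₂ j) z|) :
    ∃ c ∈ AddSubgroup.closure (GGset 2 2 1), KZ.of s - c ∈ KZ.relations := by
  set α : ℚ := dd X d with hα
  set g : (Fin (2 + 1) → ℚ) × ℚ := X - α • frameZ d with hg
  have hdg : dd g d = 0 := by
    rw [hg, dd_sub, dd_smul, dd_frameZ d hd, mul_one, sub_self]
  have hXg : pullC α (g.1 (Fin.last 2)) (restr 2 g) X = frameZ d := by
    rw [pullC_eq, hg, sub_sub_cancel, smul_smul, inv_mul_cancel₀ hX, one_smul]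
  have hGg : dd (pullC α (g.1 (Fin.last 2)) (restr 2 g) G) d = 0 := by
    rw [pullC_eq, dd_smul, dd_sub, hG, hdg, sub_zero, mul_zero]
  have hcg : dd (pullC α (g.1 (Fin.last 2)) (restr 2 g) 0) d = 0 := by
    rw [pullC_eq, dd_smul, dd_sub, hdg, sub_zero]
    simp [dd]
  -- the pull-back `t = α t* + g`
  obtain ⟨s', -, hbd', hdom', hint', hrel'⟩ := pull (fun _ => α) (fun _ => g.1 (Fin.last 2))
    (fun _ => restr 2 g) s M L e p ℓ₁ ℓ₂ 0 1 (fun _ => some 0) (fun _ => Sum.inr b₁) (fun _ => Sum.inr b₂)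
    hbd hdom hint (fun _ => hX) (fun i j hij => by rcases hij with h | h <;> cases h)
  suffices hs' : ∃ c ∈ AddSubgroup.closure (GGset 2 2 1), KZ.of s' - c ∈ KZ.relations by
    obtain ⟨c₀, hc₀, hc₀'⟩ := hs'
    exact ⟨c₀, hc₀, by have := add_mem hrel' hc₀'; rwa [sub_add_sub_cancel] at this⟩
  -- the pulled bounds: `{Z, (G − g)/α}` in some order
  set lo₀ : (Fin (2 + 1) → ℚ) × ℚ := pullC α (g.1 (Fin.last 2)) (restr 2 g) (if 0 < α then b₁ else b₂) with hlo₀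
  set hi₀ : (Fin (2 + 1) → ℚ) × ℚ := pullC α (g.1 (Fin.last 2)) (restr 2 g) (if 0 < α then b₂ else b₁) with hhi₀
  have hdom'' : s'.domain = gDom 2 1 m' M (fun _ => Sum.inr lo₀) (fun _ => Sum.inr hi₀) := by
    rw [hdom']
    congr 1
    · funext i
      simp only [pullLo, hlo₀]
      split_ifs <;> rfl
    · funext i
      simp only [pullHi, hhi₀]
      split_ifs <;> rfl
  have hlohi : (lo₀ = frameZ d ∧ dd hi₀ d = 0) ∨ (hi₀ = frameZ d ∧ dd lo₀ d = 0) := by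
    rcases hXG with ⟨h1, h2⟩ | ⟨h1, h2⟩
    · by_cases hp : 0 < α
      · left
        rw [hlo₀, hhi₀, if_pos hp, if_pos hp, h1, h2]
        exact ⟨hXg, hGg⟩
      · right
        rw [hlo₀, hhi₀, if_neg hp, if_neg hp, h1, h2]
        exact ⟨hXg, hGg⟩
    · by_cases hp : 0 < α
      · right
        rw [hlo₀, hhi₀, if_pos hp, if_pos hp, h1, h2]
        exact ⟨hXg, hGg⟩
      · left
        rw [hlo₀, hhi₀, if_neg hp, if_neg hp, h1, h2]
        exact ⟨hXg, hGg⟩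
  have hrows : ∀ z ∈ s'.domain, ∀ i, 0 < affF 2 1 (M i) z := fun z hz => by
    rw [hdom'', mem_gDom_one] at hz
    exact hz.1
  refine good_frame s' M (jjL L ℓ₂) (jjE e) (rename Fin.castSucc (MvPolynomial.C (pullQ (B := 2) (K := 1)
      (fun _ => α) (fun _ => some 0)) * p))
    (pullC α (g.1 (Fin.last 2)) (restr 2 g) 0) lo₀ hi₀ d hd hbd' hdom'' (fun z hz => ?_) hcg hlohi hact
    (fun j hα' he z hz => hpole j hα' he z (hrows z hz))
    (fun j j' hα₁ hα₂ he he' hne => ?_)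
  · rw [hint' hz]
    exact glit_jj _ L e ℓ₁ ℓ₂ _ z
  · obtain ⟨C, hC⟩ := hrat j j' hα₁ hα₂ he he' hne
    exact ⟨C, fun z hz => hC z (hrows z hz)⟩

/-- **Re-selection of the distinguished coordinate for a one-fibre band.** See the module
docstring. -/
theorem good_reselect (s : KZ.IntegralRep (2 + 1 + 1)) (M : Fin m' → (Fin (2 + 1) → ℚ) × ℚ)
    (p : MvPolynomial (Fin 2) ℚ) (u v : (Fin (2 + 1) → ℚ) × ℚ) (hbd : Bornology.IsBounded s.domain)
    (hdom : s.domain = gDom 2 1 m' M (fun _ => Sum.inr u) (fun _ => Sum.inr v))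
    (hint : EqOn s.integrand (glit 2 1 p L e ℓ₁ ℓ₂ 0 1 (fun _ => some 0)) s.domain)
    (huv : ∀ z : Fin (2 + 1 + 1) → ℝ, (∀ j, 0 < affF 2 1 (M j) z) → affF 2 1 u z < affF 2 1 v z)
    (d : Fin (2 + 1) → ℚ) (hd : d (Fin.last 2) ≠ 0) (θ : ℚ) (hθ0 : 0 < θ) (hθ1 : θ < 1)
    (hdu : dd u d ≠ 0) (hlev : dd u d + θ * dd (v - u) d = 0)
    (hact : ∀ j, jjE e j ≠ 0 → (jjL L ℓ₂ j).1 ≠ 0 → dd (jjL L ℓ₂ j) d ≠ 0)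
    (hpole : ∀ j, dd (jjL L ℓ₂ j) d ≠ 0 → jjE e j ≠ 0 → ∀ z : Fin (2 + 1 + 1) → ℝ,
      (∀ i, 0 < affF 2 1 (M i) z) → affF 2 1 (jjL L ℓ₂ j) z ≠ 0)
    (hrat : ∀ j j', dd (jjL L ℓ₂ j) d ≠ 0 → dd (jjL L ℓ₂ j') d ≠ 0 → jjE e j ≠ 0 → jjE e j' ≠ 0 →
      dd (jjL L ℓ₂ j') d • jjL L ℓ₂ j ≠ dd (jjL L ℓ₂ j) d • jjL L ℓ₂ j' →
      ∃ C : ℝ, ∀ z : Fin (2 + 1 + 1) → ℝ, (∀ i, 0 < affF 2 1 (M i) z) →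
      |affF 2 1 (jjL L ℓ₂ j') z| ≤ C * |(dd (jjL L ℓ₂ j) d : ℝ) * affF 2 1 (jjL L ℓ₂ j') z -
        (dd (jjL L ℓ₂ j') d : ℝ) * affF 2 1 (jjL L ℓ₂ j) z|) :
    ∃ c ∈ AddSubgroup.closure (GGset 2 2 1), KZ.of s - c ∈ KZ.relations := by
  set κ : (Fin (2 + 1) → ℚ) × ℚ := u + θ • (v - u) with hκ
  have hκd : dd κ d = 0 := by rw [hκ, dd_add, dd_smul]; exact hlev
  have hdv : dd v d ≠ 0 := by
    intro hv
    rw [dd_sub, hv, zero_sub, mul_neg, ← sub_eq_add_neg] at hlev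
    have h1 : dd u d * (1 - θ) = 0 := by linear_combination hlev
    rcases mul_eq_zero.1 h1 with h | h
    · exact hdu h
    · exact absurd (by linarith : θ = 1) (ne_of_lt hθ1)
  have hθ0' : (0 : ℝ) < θ := by exact_mod_cast hθ0
  have hθ1' : (θ : ℝ) < 1 := by exact_mod_cast hθ1
  -- `u < κ < v` on the base cell
  have hgeo : ∀ z : Fin (2 + 1 + 1) → ℝ, (∀ j, 0 < affF 2 1 (M j) z) →
      affF 2 1 u z < affF 2 1 κ z ∧ affF 2 1 κ z < affF 2 1 v z := by
    intro z hz
    have hlt := huv z hz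
    have hκz : affF 2 1 κ z = affF 2 1 u z + (θ : ℝ) * (affF 2 1 v z - affF 2 1 u z) := by
      rw [hκ, ← affF_sub'', ← affF_smul']
      simp only [affF, Prod.fst_add, Prod.snd_add, Pi.add_apply, Rat.cast_add, add_mul,
        Finset.sum_add_distrib]
      ring
    rw [hκz]
    constructor <;> nlinarith
  -- cut the fibre at `κ` (rule 1a)
  obtain ⟨s₁, s₂, hd₁, hd₂, hi₁, hi₂, hsub₁, hsub₂, hrel⟩ := cutFibre s M (fun _ => Sum.inr u)
    (fun _ => Sum.inr v) hdom 0 κ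
    (fun z hz => by
      rw [update_fin_one, mem_gDom_one] at hz
      exact (hgeo z hz.1).2.le)
    (fun z hz => by
      rw [update_fin_one, mem_gDom_one] at hz
      exact (hgeo z hz.1).1.le)
  rw [update_fin_one] at hd₁ hd₂
  refine good_of_split hrel ?_ ?_
  · exact good_half L e ℓ₁ ℓ₂ s₁ M p u κ u κ d hd (hbd.subset hsub₁) hd₁ (by rw [hi₁]; exact hint.mono hsub₁)
      (Or.inl ⟨rfl, rfl⟩) hdu hκd hact hpole hrat
  · exact good_half L e ℓ₁ ℓ₂ s₂ M p κ v v κ d hd (hbd.subset hsub₂) hd₂ (by rw [hi₂]; exact hint.mono hsub₂)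
      (Or.inr ⟨rfl, rfl⟩) hdv hκd hact hpole hrat

end Reselect

end RebasePos

/-- **Registered part of `stub_rebaseSimplePosOnePos` (line `janus-bands`): re-selection of the
distinguished coordinate for a one-fibre band over the base `(x₁, x₂, y)`.** A literal one-fibre
datum `[{rows, u < t < v}, p(x')/∏ Lⱼ(x')^{eⱼ} · 1/(y − ℓ₂(x')) · 1/t]` together with a rational
base direction `d` (`d_y ≠ 0`) moving the lower bound and fixing a level `u + θ (v − u)`,
`0 < θ < 1`, lies in the subgroup generated by `GG 2 2 1` modulo `KZ.relations` as soon as its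
letters read over the full base (the `Lⱼ` and the pole form `y − ℓ₂`) satisfy in the direction
`d` the hypotheses of the separation engine on the base cell (`RebasePos.good_reselect`: fibre
cut at the level, two affine pull-backs, base change along `d`, structure-preserving engine;
rules 1a, 1b, 2). -/
theorem rebaseSimplePos_reselect (m m' : ℕ) (L : Fin m → (Fin 2 → ℚ) × ℚ) (e : Fin m → ℕ) (ℓ₁ ℓ₂ : (Fin 2 → ℚ) × ℚ) (s : KZ.IntegralRep (2 + 1 + 1)) (M : Fin m' → (Fin (2 + 1) → ℚ) × ℚ) (p : MvPolynomial (Fin 2) ℚ) (u v : (Fin (2 + 1) → ℚ) × ℚ) (hbd : Bornology.IsBounded s.domain) (hdom : s.domain = SeparatePos.gDom 2 1 m' M (fun _ => Sum.inr u) (fun _ => Sum.inr v)) (hint : Set.EqOn s.integrand (RebasePos.glit 2 1 p L e ℓ₁ ℓ₂ 0 1 (fun _ => some 0)) s.domain) (huv : ∀ z : Fin (2 + 1 + 1) → ℝ, (∀ j, 0 < SeparatePos.affF 2 1 (M j) z) → SeparatePos.affF 2 1 u z < SeparatePos.affF 2 1 v z) (d : Fin (2 + 1) → ℚ) (hd :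 d (Fin.last 2) ≠ 0) (θ : ℚ) (hθ0 : 0 < θ) (hθ1 : θ < 1) (hdu : RebasePos.dd u d ≠ 0) (hlev : RebasePos.dd u d + θ * RebasePos.dd (v - u) d = 0) (hact : ∀ j, RebasePos.jjE e j ≠ 0 → (RebasePos.jjL L ℓ₂ j).1 ≠ 0 → RebasePos.dd (RebasePos.jjL L ℓ₂ j) d ≠ 0) (hpole : ∀ j, RebasePos.dd (RebasePos.jjL L ℓ₂ j) d ≠ 0 → RebasePos.jjE e j ≠ 0 → ∀ z : Fin (2 + 1 + 1) → ℝ, (∀ i, 0 < SeparatePos.affF 2 1 (M i) z) → SeparatePos.affF 2 1 (RebasePos.jjL L ℓ₂ j) z ≠ 0) (hrat : ∀ j j', RebasePos.dd (RebasePos.jjL L ℓ₂ j) d ≠ 0 → RebasePos.dd (RebasePos.jjL L ℓ₂ j') d ≠ 0 → RebasePos.jjE e j ≠ 0 → RebasePos.jjE e j' ≠ 0 → RebasePos.dd (RebasePos.jjL L ℓ₂ j') d • RebasePos.jjL L ℓ₂ j ≠ RebasePos.dd (RebasePos.jjL L ℓ₂ j) d • RebasePos.jjL L ℓ₂ j'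 → ∃ C : ℝ, ∀ z : Fin (2 + 1 + 1) → ℝ, (∀ i, 0 < SeparatePos.affF 2 1 (M i) z) → |SeparatePos.affF 2 1 (RebasePos.jjL L ℓ₂ j') z| ≤ C * |(RebasePos.dd (RebasePos.jjL L ℓ₂ j) d : ℝ) * SeparatePos.affF 2 1 (RebasePos.jjL L ℓ₂ j') z - (RebasePos.dd (RebasePos.jjL L ℓ₂ j') d : ℝ) * SeparatePos.affF 2 1 (RebasePos.jjL L ℓ₂ j) z|) : ∃ c ∈ AddSubgroup.closure (SeparatePos.GGset 2 2 1), KZ.of s - c ∈ KZ.relations :=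
  RebasePos.good_reselect L e ℓ₁ ℓ₂ s M p u v hbd hdom hint huv d hd θ hθ0 hθ1 hdu hlev hact hpole hrat

end Summit.KontsevichZagierPeriods.ArrangementNormalForm.JanusBands
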